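import Summits.Ventures.HSemireg.WedgeHankelRecurrenceGaussClassicalSquareSums

/-!
# Venture HSemireg — **THE PHYSICISTS' HERMITE NORMALISATION**: the recurrence `a ≡ 0`, `b_{n+1} = (n+1)∕2` (monic `2^{−n} H_n`) is the `1∕√2`-rescaling of Mathlib's probabilists' family:
# **`q_n = (√2)^{−n} · He_n(√2 X)`** (N324), its zeros are `y_k = x_k∕√2` (`x` the zeros of `He_{t+1}`), STIELTJES' equilibrium takes its cleanest form **`Σ_{j ≠ k} 1∕(y_k − y_j) = y_k`** (the equation
# `H'' − 2xH' + 2nH = 0`), and TURÁN's inequality reads `q_{n+1}² − q_{n+2} q_n ≥ n!∕2^{n+1}` (N371)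

HONEST FRAMING. Part of the Lean index of the computation cell `pub-hsemireg` (seat p10 gen 46, Sunday typer «UNIFORM-IN-n»).  Real polynomials, finite sums and `Real.sqrt` only; no variety, no cohomology
theory, no sheaf, no Ext group and no semiregularity map is constructed here; nothing here says that HC / HC_CM / HC_AV holds; no Literature fact (unproved `Prop`) is declared or used.  Custodian
versions as in `WedgeHankelSiegelIdeal` (1/3).
SOURCES (cited).  G. Szegő, *Orthogonal Polynomials*, (5.5.3), (5.5.8), §6.7 (6.7.9)–(6.7.10) (Stieltjes: the zeros of `H_n` solve `Σ_{j≠k} 1∕(x_k − x_j) = x_k`); M. Abramowitz, I. Stegun, *Handbook*,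
22.5.18–19 (`He_n(x) = 2^{−n∕2} H_n(x∕√2)`); T. J. Stieltjes, Acta Math. 6 (1885) 321–326; P. Turán ∕ G. Szegő (1948) (Turán's inequality for Hermite polynomials).
PROOF TYPED HERE.  N324 `recurrence_scale_unique` ∕ `recurrence_scale_spec` with `c = (√2)⁻¹` (`c² (n+1) = (n+1)∕2`); the zeros scale, so N388 `hermite_zeros_electrostatic` (`Σ = x_k∕2`) becomes
`Σ = y_k` after multiplying by `√2`; N371 `turan_inequality_recurrence` with `b_1 ∏_{j ≤ n} b_j = n!∕2^{n+1}`.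
DEDUP DISCLOSURE (`rg -n -i 'physicist|hermitePhys|sqrt 2' Summits/Ventures/HSemireg/WedgeHankelRecurrenceGauss*`, 2026-09-03): N359 ∕ N371 ∕ N388 treat Mathlib's `He_n` only.  The 4 names below: 0 hits
tree-wide.

WHAT IS IN THE TREE.  N324 `recurrence_scale_unique`, `recurrence_scale_spec`; N359 `hermite_real_recurrence`, `hermite_zeros`; N388 `hermite_zeros_electrostatic`; N371 `turan_inequality_recurrence`.
THIS FILE (namespace `Summit.Ventures.HSemireg.Wedge.HankelOuter` continued; CHAINED on N394 (import only); 0 definitions):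
* §1160 **`hermitePhys_eq_scaled_hermite`**, **`hermitePhys_zeros`** (zeros `x_k∕√2`, product form), **`hermitePhys_zeros_electrostatic`** (`Σ_{j≠k} 1∕(y_k − y_j) = y_k`), `hermitePhys_turan`
  (`n!∕2^{n+1} ≤ q_{n+1}(x)² − q_{n+2}(x) q_n(x)`).
CAVEATS.  Mathlib has no physicists' `H_n`; everything is phrased for the monic recurrence `(0, (n+1)∕2)` and `He_n`.  Nothing Ext-side.  New names only.
-/

open Module Polynomial
open scoped Matrix Polynomial

namespace Summit.Ventures.HSemireg.Wedge.HankelOuter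

/-! ## §1160. The physicists' Hermite recurrence -/

/-- **`q_n = (√2)^{−n} He_n(√2 X)`** for any solution of the recurrence `a ≡ 0`, `b_{n+1} = (n+1)∕2`. [Abramowitz–Stegun 22.5.18; this file, §1160] -/
theorem hermitePhys_eq_scaled_hermite {q : ℕ → ℝ[X]} {a b : ℕ → ℝ} (hq0 : q 0 = 1) (hq1 : q 1 = Polynomial.X - C (a 0))
    (hrec : ∀ n, q (n + 2) = (Polynomial.X - C (a (n + 1))) * q (n + 1) - C (b (n + 1)) * q n) (ha : ∀ n, a n = 0) (hb : ∀ n, b (n + 1) = ((n : ℝ) + 1) / 2) (n : ℕ) :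
    q n = C (((Real.sqrt 2)⁻¹) ^ n) * ((Polynomial.hermite n).map (Int.castRingHom ℝ)).comp (C ((Real.sqrt 2)⁻¹)⁻¹ * Polynomial.X) := by
  obtain ⟨h0, h1, hr⟩ := hermite_real_recurrence
  have hc : (Real.sqrt 2)⁻¹ ≠ 0 := inv_ne_zero (Real.sqrt_ne_zero'.2 two_pos)
  have hc2 : ((Real.sqrt 2)⁻¹) ^ 2 = 1 / 2 := by rw [inv_pow, Real.sq_sqrt (by norm_num : (0 : ℝ) ≤ 2)]; norm_num
  refine recurrence_scale_unique (q := fun m => (Polynomial.hermite m).map (Int.castRingHom ℝ)) (a := fun _ => (0 : ℝ)) (b := fun m => (m : ℝ)) h0 h1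
    (fun m => by rw [hr m]; push_cast; rfl) hc hq0 (by rw [hq1, ha, mul_zero]) (fun m => by rw [hrec m, ha, hb, mul_zero, hc2]; push_cast; ring_nf) n

/-- **THE ZEROS OF THE PHYSICISTS' RECURRENCE ARE `x_k∕√2`** (`x` the increasing zeros of `He_{t+1}`): increasing, product form. [this file, §1160] -/
theorem hermitePhys_zeros {q : ℕ → ℝ[X]} {a b : ℕ → ℝ} (hq0 : q 0 = 1) (hq1 : q 1 = Polynomial.X - C (a 0))
    (hrec : ∀ n, q (n + 2) = (Polynomial.X - C (a (n + 1))) * q (n + 1) - C (b (n + 1)) * q n) (ha : ∀ n, a n = 0) (hb : ∀ n, b (n + 1) = ((n : ℝ) + 1) / 2)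
    {t : ℕ} {x : Fin (t + 1) → ℝ} (hx : StrictMono x) (hxq : (Polynomial.hermite (t + 1)).map (Int.castRingHom ℝ) = ∏ k, (Polynomial.X - C (x k))) :
    StrictMono (fun k => (Real.sqrt 2)⁻¹ * x k) ∧ q (t + 1) = ∏ k, (Polynomial.X - C ((Real.sqrt 2)⁻¹ * x k)) := by
  obtain ⟨h0, h1, hr⟩ := hermite_real_recurrence
  have hc : (Real.sqrt 2)⁻¹ ≠ 0 := inv_ne_zero (Real.sqrt_ne_zero'.2 two_pos)
  have hcpos : 0 < (Real.sqrt 2)⁻¹ := inv_pos.2 (Real.sqrt_pos.2 two_pos)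
  obtain ⟨-, -, -, hprod⟩ := recurrence_scale_spec (q := fun m => (Polynomial.hermite m).map (Int.castRingHom ℝ)) (a := fun _ => (0 : ℝ)) (b := fun m => (m : ℝ)) h0 h1
    (fun m => by rw [hr m]; push_cast; rfl) hc
  refine ⟨hx.const_mul hcpos, ?_⟩
  rw [hermitePhys_eq_scaled_hermite hq0 hq1 hrec ha hb (t + 1)]
  exact hprod hxq

/-- **STIELTJES' EQUILIBRIUM, PHYSICISTS' FORM: `Σ_{j ≠ k} 1∕(y_k − y_j) = y_k`** for the zeros `y_k = x_k∕√2` of the recurrence `(0, (n+1)∕2)` (i.e. of `H_{t+1}`). [Szegő (6.7.10); Stieltjes 1885; this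
file, §1160] -/
theorem hermitePhys_zeros_electrostatic {t : ℕ} {x : Fin (t + 1) → ℝ} (hx : StrictMono x)
    (hxq : (Polynomial.hermite (t + 1)).map (Int.castRingHom ℝ) = ∏ k, (Polynomial.X - C (x k))) (k : Fin (t + 1)) :
    ∑ j ∈ Finset.univ.erase k, ((Real.sqrt 2)⁻¹ * x k - (Real.sqrt 2)⁻¹ * x j)⁻¹ = (Real.sqrt 2)⁻¹ * x k := by
  have h := hermite_zeros_electrostatic hx hxq k
  have hs : Real.sqrt 2 ≠ 0 := Real.sqrt_ne_zero'.2 two_pos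
  have hs2 : Real.sqrt 2 * Real.sqrt 2 = 2 := Real.mul_self_sqrt (by norm_num)
  have hterm : ∀ j, ((Real.sqrt 2)⁻¹ * x k - (Real.sqrt 2)⁻¹ * x j)⁻¹ = Real.sqrt 2 * (x k - x j)⁻¹ := fun j => by
    rw [← mul_sub, mul_inv, inv_inv]
  rw [Finset.sum_congr rfl fun j _ => hterm j, ← Finset.mul_sum, h]
  have hsq : Real.sqrt 2 ^ 2 = 2 := by rw [sq, hs2]
  field_simp
  rw [hsq]; ring

/-- **TURÁN, PHYSICISTS' FORM: `n!∕2^{n+1} ≤ q_{n+1}(x)² − q_{n+2}(x) q_n(x)`** for the recurrence `(0, (n+1)∕2)` — i.e. `H_{n+1}² − H_{n+2} H_n ≥ 2^{n+1} n!`. [Turán 1950; Szegő 1948; this file, §1160] -/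
theorem hermitePhys_turan {q : ℕ → ℝ[X]} {a b : ℕ → ℝ} (hq0 : q 0 = 1) (hq1 : q 1 = Polynomial.X - C (a 0))
    (hrec : ∀ n, q (n + 2) = (Polynomial.X - C (a (n + 1))) * q (n + 1) - C (b (n + 1)) * q n) (ha : ∀ n, a n = 0) (hb : ∀ n, b (n + 1) = ((n : ℝ) + 1) / 2) (hb0 : 0 < b 0)
    (n : ℕ) (x : ℝ) : ((Nat.factorial n : ℕ) : ℝ) / 2 ^ (n + 1) ≤ (q (n + 1) ^ 2 - q (n + 2) * q n).eval x := by
  have hbpos : ∀ j, 0 < b j := fun j => by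
    rcases j with _ | m
    · exact hb0
    · rw [hb]; positivity
  have hmono : ∀ m, 1 ≤ m → b m ≤ b (m + 1) := fun m hm => by
    obtain ⟨k, rfl⟩ : ∃ k, m = k + 1 := ⟨m - 1, by omega⟩
    rw [hb, hb]; push_cast; linarith
  have h := (turan_inequality_recurrence hq0 hq1 hrec (fun m => by rw [ha, ha]) hbpos hmono n x).1
  have hprod : b 1 * ∏ j ∈ Finset.Ico 1 (n + 1), b j = ((Nat.factorial n : ℕ) : ℝ) / 2 ^ (n + 1) := by
    have hbv : ∀ j ∈ Finset.Ico 1 (n + 1), b j = (j : ℝ) / 2 := fun j hj => by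
      obtain ⟨k, rfl⟩ : ∃ k, j = k + 1 := ⟨j - 1, by have := (Finset.mem_Ico.1 hj).1; omega⟩
      rw [hb]; push_cast; ring
    rw [Finset.prod_congr rfl hbv, Finset.prod_div_distrib, Finset.prod_const, Nat.card_Ico, Nat.add_sub_cancel, ← Nat.cast_prod, Finset.prod_Ico_id_eq_factorial,
      show b 1 = 1 / 2 by have := hb 0; rw [zero_add, Nat.cast_zero, zero_add] at this; exact this]
    ring
  rw [← hprod]; exact h

end Summit.Ventures.HSemireg.Wedge.HankelOuter
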